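import Literature.AlgebraicGeometry.Resolution.ExtAnnihilatorStaircase
import Literature.AlgebraicGeometry.Resolution.SyzygySheaf
import Mathlib.LinearAlgebra.Dual.Lemmas
import Mathlib.Algebra.Category.ModuleCat.Projective
import Mathlib.Algebra.Homology.ShortComplex.ModuleCat
import Mathlib.CategoryTheory.Abelian.Projective.Dimension
import HarnessLib

/-!
# The staircase data of the dual of a free resolution of finite type

Topic: `Literature/AlgebraicGeometry/Resolution` (infrastructure for the annihilator theorems behind
Macaulayfication; see `ExtAnnihilatorStaircase.lean` and `ParameterColonAnnihilator.lean`).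

Let `F` be a free resolution of finite type of the `R`-module `M` (`SyzygySheaf.lean`,
`FreeResolution R M`: `⋯ → F₁ → F₀ → M → 0`, `Fᵢ = R^{rank i}`, with syzygy modules
`F.syzygy q = Im(F_{q+1} → F_q) ⊆ F_q`). This file packages the tower of short exact sequences
`0 → K_{q+1} →(j) F_q →(π) K_q → 0`, `K₀ = M`, `K_{q+1} = F.syzygy q`, as objects and morphisms of
`ModuleCat R` (`F.syzygyObj`, `F.coverObj`, `F.coverπ`, `F.syzygyι`; the identification
`F.syzygyObj (q+1) ≃ₗ[R] F.syzygy q` is the identity, `F.syzygySuccEquiv`), and builds the dual data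
`Z^q = K_q^* = Hom(K_q, R)`, `G^q = F_q^*`, `B^{q+1} = im(F_q^* → K_{q+1}^*)`, `E^q = K_q^* / B^q`
(so that `E^q ≅ Ext¹(K_{q-1}, R) ≅ Ext^q(M, R)` for `q ≥ 1`), with the short exact sequences
`0 → B^q → Z^q → E^q → 0` and `0 → Z^q → G^q → B^{q+1} → 0` making up a `StaircaseData`
(`ExtAnnihilatorStaircase.lean`).

## Main statements

* `FreeResolution.shortExact_syzygy` — `0 → K_{q+1} → F_q → K_q → 0` in `ModuleCat R`.
* `FreeResolution.staircase F : StaircaseData R` — the dual data; `F.EMod q` its modules `E^q`.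
* `FreeResolution.smul_EMod_eq_zero_of_mem_annihilator` — **`Ann M` annihilates every `E^q`**
  (the classical null-homotopy of multiplication by `a ∈ Ann M` on a free resolution).
* `FreeResolution.projective_syzygyObj_of_hasProjectiveDimensionLE`,
  `FreeResolution.projective_B_of_hasProjectiveDimensionLE` — if `pd M ≤ n` then `K_q` is
  projective for `q ≥ n` and `B^q` is projective for `q > n`.

[folklore; cf. BrunsHerzog1998, proof of Thm. 8.1.2]
-/

noncomputable section

open CategoryTheory CategoryTheory.Abelian CategoryTheory.Limits Module

universe u

namespace Literature.AlgebraicGeometry.Resolution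

namespace FreeResolution

variable {R : Type u} [CommRing R] {M : Type u} [AddCommGroup M] [Module R M]
variable (F : FreeResolution R M)

/-! ## The syzygy tower in `ModuleCat R` -/

/-- The modules `K_q` of the tower: `K₀ = M`, `K_{q+1} = F.syzygy q = Im(F_{q+1} → F_q)`
(the `(q+1)`-st syzygy of `M`). [folklore] -/
abbrev syzygyObj : ℕ → ModuleCat.{u} R
  | 0 => ModuleCat.of R M
  | q + 1 => ModuleCat.of R (F.syzygy q)

/-- The finite free modules `F_q = R^{rank q}`. [folklore] -/
abbrev coverObj (q : ℕ) : ModuleCat.{u} R := ModuleCat.of R (Fin (F.rank q) → R)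

/-- `K_{q+1}` is `F.syzygy q` (the identity). [folklore] -/
def syzygySuccEquiv (q : ℕ) : F.syzygyObj (q + 1) ≃ₗ[R] F.syzygy q := LinearEquiv.refl R _

/-- `π_q : F_q ↠ K_q`: the augmentation `ε` for `q = 0`, the corestricted differential
`F.toSyzygy q'` for `q = q' + 1`. [folklore] -/
def coverπ : (q : ℕ) → (F.coverObj q ⟶ F.syzygyObj q)
  | 0 => ModuleCat.ofHom F.ε
  | q + 1 => ModuleCat.ofHom ((F.syzygySuccEquiv q).symm.toLinearMap ∘ₗ F.toSyzygy q)

/-- `j_q : K_{q+1} = F.syzygy q ↪ F_q`. [folklore] -/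
def syzygyι (q : ℕ) : F.syzygyObj (q + 1) ⟶ F.coverObj q :=
  ModuleCat.ofHom ((F.syzygy q).subtype ∘ₗ (F.syzygySuccEquiv q).toLinearMap)

/-- `π₀ = ε`. [folklore] -/
theorem coverπ_zero_apply (x : F.coverObj 0) : (F.coverπ 0).hom x = F.ε x := rfl

/-- `π_{q+1} = toSyzygy q`. [folklore] -/
theorem coverπ_succ_apply (q : ℕ) (x : F.coverObj (q + 1)) :
    F.syzygySuccEquiv q ((F.coverπ (q + 1)).hom x) = F.toSyzygy q x := rfl

/-- `π_q` is surjective. [folklore] -/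
theorem coverπ_surjective : ∀ q : ℕ, Function.Surjective (F.coverπ q).hom
  | 0 => F.ε_surjective
  | q + 1 => (F.syzygySuccEquiv q).symm.surjective.comp (F.toSyzygy_surjective q)

/-- `j_q` is the inclusion `F.syzygy q ⊆ F_q`. [folklore] -/
theorem syzygyι_apply (q : ℕ) (y : F.syzygyObj (q + 1)) :
    (F.syzygyι q).hom y = ((F.syzygySuccEquiv q y : F.syzygy q) : Fin (F.rank q) → R) := rfl

/-- `j_q` is injective. [folklore] -/
theorem syzygyι_injective (q : ℕ) : Function.Injective (F.syzygyι q).hom := by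
  intro y y' h
  rw [syzygyι_apply, syzygyι_apply] at h
  exact (F.syzygySuccEquiv q).injective (Subtype.ext h)

/-- `π_q f = 0 ↔ f ∈ F.syzygy q` (`F.syzygy 0 = ker ε`, `F.syzygy (q+1) = ker (toSyzygy q)`).
[folklore] -/
theorem coverπ_apply_eq_zero_iff : ∀ (q : ℕ) (f : F.coverObj q),
    (F.coverπ q).hom f = 0 ↔ (f : Fin (F.rank q) → R) ∈ F.syzygy q
  | 0, f => by rw [F.syzygy_zero, LinearMap.mem_ker]; rfl
  | q + 1, f => by
    rw [← F.ker_toSyzygy q, LinearMap.mem_ker, ← (F.syzygySuccEquiv q).symm.map_eq_zero_iff]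
    rfl

/-- `π_q ∘ j_q = 0` (elementwise). [folklore] -/
theorem coverπ_syzygyι_apply (q : ℕ) (y : F.syzygyObj (q + 1)) :
    (F.coverπ q).hom ((F.syzygyι q).hom y) = 0 :=
  (F.coverπ_apply_eq_zero_iff q _).mpr (F.syzygySuccEquiv q y).2

/-- `π_q ∘ j_q = 0`. [folklore] -/
theorem syzygyι_coverπ (q : ℕ) : F.syzygyι q ≫ F.coverπ q = 0 := by
  ext y
  exact F.coverπ_syzygyι_apply q y

/-- `im j_q = ker π_q`. [folklore] -/
theorem range_syzygyι (q : ℕ) :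
    LinearMap.range (F.syzygyι q).hom = LinearMap.ker (F.coverπ q).hom := by
  apply le_antisymm
  · rintro _ ⟨y, rfl⟩
    exact F.coverπ_syzygyι_apply q y
  · intro f hf
    exact ⟨(F.syzygySuccEquiv q).symm ⟨f, (F.coverπ_apply_eq_zero_iff q f).mp hf⟩, rfl⟩

/-- **Lifting into `K_{q+1}`**: a linear map `g : X → F_q` with `π_q ∘ g = 0` factors through
`j_q`. [folklore] -/
def syzygyLift {X : Type u} [AddCommGroup X] [Module R X] (q : ℕ) (g : X →ₗ[R] F.coverObj q)
    (hg : ∀ x, (F.coverπ q).hom (g x) = 0) : X →ₗ[R] F.syzygyObj (q + 1) :=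
  (F.syzygySuccEquiv q).symm.toLinearMap ∘ₗ
    LinearMap.codRestrict (F.syzygy q) g fun x => (F.coverπ_apply_eq_zero_iff q _).mp (hg x)

/-- `j_q ∘ lift(g) = g`. [folklore] -/
theorem syzygyι_syzygyLift {X : Type u} [AddCommGroup X] [Module R X] (q : ℕ)
    (g : X →ₗ[R] F.coverObj q) (hg : ∀ x, (F.coverπ q).hom (g x) = 0) (x : X) :
    (F.syzygyι q).hom (F.syzygyLift q g hg x) = g x := rfl

/-- The short complex `K_{q+1} → F_q → K_q`. [folklore] -/
abbrev syzygyComplex (q : ℕ) : ShortComplex (ModuleCat.{u} R) :=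
  ShortComplex.mk (F.syzygyι q) (F.coverπ q) (F.syzygyι_coverπ q)

/-- `0 → K_{q+1} → F_q → K_q → 0` is short exact (`exact_subtype_ε`, `exact_subtype_toSyzygy` of
`SyzygySheaf.lean`, in `ModuleCat`). [folklore] -/
theorem shortExact_syzygy (q : ℕ) : (F.syzygyComplex q).ShortExact where
  exact := by
    rw [ShortComplex.moduleCat_exact_iff_range_eq_ker]
    exact F.range_syzygyι q
  mono_f := (ModuleCat.mono_iff_injective _).mpr (F.syzygyι_injective q)
  epi_g := (ModuleCat.epi_iff_surjective _).mpr (F.coverπ_surjective q)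

/-! ## The dual data -/

/-- `ρ'_q = j_q^* : F_q^* → K_{q+1}^*`. [folklore] -/
def dualRestrict (q : ℕ) : Dual R (F.coverObj q) →ₗ[R] Dual R (F.syzygyObj (q + 1)) :=
  (F.syzygyι q).hom.dualMap

/-- `π_q^* : K_q^* → F_q^*`. [folklore] -/
def dualInflate (q : ℕ) : Dual R (F.syzygyObj q) →ₗ[R] Dual R (F.coverObj q) :=
  (F.coverπ q).hom.dualMap

/-- `j_q^*(φ) = φ ∘ j_q`. [folklore] -/
theorem dualRestrict_apply (q : ℕ) (φ : Dual R (F.coverObj q)) (y : F.syzygyObj (q + 1)) :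
    F.dualRestrict q φ y = φ ((F.syzygyι q).hom y) := rfl

/-- `π_q^*(ψ) = ψ ∘ π_q`. [folklore] -/
theorem dualInflate_apply (q : ℕ) (ψ : Dual R (F.syzygyObj q)) (f : F.coverObj q) :
    F.dualInflate q ψ f = ψ ((F.coverπ q).hom f) := rfl

/-- The boundaries `B^q ⊆ K_q^*`: `B⁰ = 0`, `B^{q+1} = im(F_q^* → K_{q+1}^*)`. [folklore] -/
def BSub : (q : ℕ) → Submodule R (Dual R (F.syzygyObj q))
  | 0 => ⊥
  | q + 1 => LinearMap.range (F.dualRestrict q)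

/-- `B^{q+1} = im(j_q^*)`. [folklore] -/
theorem BSub_succ (q : ℕ) : F.BSub (q + 1) = LinearMap.range (F.dualRestrict q) := rfl

/-- `β ∈ B^{q+1}` iff `β = φ ∘ j_q` for some `φ ∈ F_q^*`. [folklore] -/
theorem mem_BSub_succ_iff (q : ℕ) (β : Dual R (F.syzygyObj (q + 1))) :
    β ∈ F.BSub (q + 1) ↔ ∃ φ : Dual R (F.coverObj q), F.dualRestrict q φ = β := by
  rw [BSub_succ, LinearMap.mem_range]

/-- The cohomology modules `E^q = K_q^* / B^q` (so `E^q ≅ Ext^q(M, R)` for `q ≥ 1`, and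
`E⁰ = M^*`). [folklore] -/
abbrev EMod (q : ℕ) : Type u := Dual R (F.syzygyObj q) ⧸ F.BSub q

/-- `ker(j_q^*) = im(π_q^*)` (left exactness of `Hom(-, R)` on `0 → K_{q+1} → F_q → K_q → 0`).
[folklore] -/
theorem ker_dualRestrict (q : ℕ) :
    LinearMap.ker (F.dualRestrict q) = LinearMap.range (F.dualInflate q) := by
  rw [dualRestrict, dualInflate, LinearMap.ker_dualMap_eq_dualAnnihilator_range,
    LinearMap.range_dualMap_eq_dualAnnihilator_ker_of_surjective _ (F.coverπ_surjective q),
    range_syzygyι]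

/-- `π_q^*` is injective. [folklore] -/
theorem dualInflate_injective (q : ℕ) : Function.Injective (F.dualInflate q) :=
  LinearMap.dualMap_injective_of_surjective (F.coverπ_surjective q)

/-- `j_q^* ∘ π_q^* = 0`. [folklore] -/
theorem dualRestrict_dualInflate (q : ℕ) (ψ : Dual R (F.syzygyObj q)) :
    F.dualRestrict q (F.dualInflate q ψ) = 0 := by
  ext y
  rw [dualRestrict_apply, dualInflate_apply, coverπ_syzygyι_apply, map_zero, LinearMap.zero_apply]

/-- **The staircase data of the dual resolution of `M`**: `Z^q = K_q^*`, `G^q = F_q^*`,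
`B^q`, `E^q = K_q^*/B^q`, with `0 → B^q → Z^q → E^q → 0` and `0 → Z^q → G^q → B^{q+1} → 0`.
[cite: BrunsHerzog1998, proof of Thm. 8.1.2 (setting)] -/
def staircase : StaircaseData R where
  Z q := ModuleCat.of R (Dual R (F.syzygyObj q))
  G q := ModuleCat.of R (Dual R (F.coverObj q))
  B q := ModuleCat.of R (F.BSub q)
  E q := ModuleCat.of R (F.EMod q)
  i q := ModuleCat.ofHom (F.BSub q).subtype
  p q := ModuleCat.ofHom (F.BSub q).mkQ
  ι q := ModuleCat.ofHom (F.dualInflate q)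
  ρ q := ModuleCat.ofHom (F.dualRestrict q).rangeRestrict
  i_p q := by
    ext x
    simp
  ι_ρ q := by
    ext ψ : 2
    apply Subtype.ext
    change F.dualRestrict q (F.dualInflate q ψ) = 0
    exact F.dualRestrict_dualInflate q ψ
  shortExact₁ q :=
    { exact := by
        rw [ShortComplex.moduleCat_exact_iff_range_eq_ker]
        simp
      mono_f := (ModuleCat.mono_iff_injective _).mpr (F.BSub q).injective_subtype
      epi_g := (ModuleCat.epi_iff_surjective _).mpr (Submodule.mkQ_surjective _) }
  shortExact₂ q :=
    { exact := by
        rw [ShortComplex.moduleCat_exact_iff_range_eq_ker]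
        change LinearMap.range (F.dualInflate q) = LinearMap.ker (F.dualRestrict q).rangeRestrict
        rw [LinearMap.ker_rangeRestrict, ker_dualRestrict]
      mono_f := (ModuleCat.mono_iff_injective _).mpr (F.dualInflate_injective q)
      epi_g := (ModuleCat.epi_iff_surjective _).mpr (LinearMap.surjective_rangeRestrict _) }
  projective q := inferInstance

/-- `Z^q = K_q^*`. [folklore] -/
@[simp] theorem staircase_Z (q : ℕ) :
    F.staircase.Z q = ModuleCat.of R (Dual R (F.syzygyObj q)) := rfl
/-- `G^q = F_q^*`. [folklore] -/
@[simp] theorem staircase_G (q : ℕ) :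
    F.staircase.G q = ModuleCat.of R (Dual R (F.coverObj q)) := rfl
/-- `B^q`. [folklore] -/
@[simp] theorem staircase_B (q : ℕ) : F.staircase.B q = ModuleCat.of R (F.BSub q) := rfl
/-- `E^q = K_q^*/B^q`. [folklore] -/
@[simp] theorem staircase_E (q : ℕ) : F.staircase.E q = ModuleCat.of R (F.EMod q) := rfl
/-- `i = (B^q ⊆ Z^q)`. [folklore] -/
theorem staircase_i (q : ℕ) : F.staircase.i q = ModuleCat.ofHom (F.BSub q).subtype := rfl
/-- `p = (Z^q ↠ E^q)`. [folklore] -/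
theorem staircase_p (q : ℕ) : F.staircase.p q = ModuleCat.ofHom (F.BSub q).mkQ := rfl
/-- `ι = π_q^*`. [folklore] -/
theorem staircase_ι (q : ℕ) : F.staircase.ι q = ModuleCat.ofHom (F.dualInflate q) := rfl
/-- `ρ = j_q^*` (corestricted). [folklore] -/
theorem staircase_ρ (q : ℕ) :
    F.staircase.ρ q = ModuleCat.ofHom (F.dualRestrict q).rangeRestrict := rfl

/-! ## `Ann M` annihilates the cohomology modules `E^q` -/

/-- **Null-homotopy of `a ∈ Ann M`, syzygy form**: for every `q` there is `θ : K_q → F_q` with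
`π_q ∘ θ = a • id`. [folklore] -/
theorem exists_lift_smul_of_mem_annihilator {a : R} (ha : a ∈ Module.annihilator R M) :
    ∀ q : ℕ, ∃ θ : F.syzygyObj q →ₗ[R] F.coverObj q, ∀ y, (F.coverπ q).hom (θ y) = a • y := by
  intro q
  induction q with
  | zero =>
    refine ⟨0, fun y => ?_⟩
    rw [LinearMap.zero_apply, map_zero]
    exact (Module.mem_annihilator.mp ha y).symm
  | succ q ih =>
    obtain ⟨θ, hθ⟩ := ih
    -- `λ = a • id - θ ∘ π : F_q → F_q` lands in `ker π_q = K_{q+1}`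
    let lam : F.coverObj q →ₗ[R] F.coverObj q := a • LinearMap.id - θ ∘ₗ (F.coverπ q).hom
    have hlam : ∀ f, (F.coverπ q).hom (lam f) = 0 := by
      intro f
      simp only [lam, LinearMap.sub_apply, LinearMap.smul_apply, LinearMap.id_coe, id_eq,
        LinearMap.coe_comp, Function.comp_apply, map_sub, map_smul, hθ, sub_self]
    -- lift `λ' : F_q → K_{q+1}` along the cover `π_{q+1}` using projectivity of `F_q`
    obtain ⟨μ, hμ⟩ := Module.projective_lifting_property (F.coverπ (q + 1)).hom
      (F.syzygyLift q lam hlam) (F.coverπ_surjective (q + 1))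
    refine ⟨μ ∘ₗ (F.syzygyι q).hom, fun y => ?_⟩
    have hμy := LinearMap.congr_fun hμ ((F.syzygyι q).hom y)
    simp only [LinearMap.coe_comp, Function.comp_apply] at hμy ⊢
    rw [hμy]
    apply F.syzygyι_injective q
    rw [syzygyι_syzygyLift, map_smul]
    change a • (F.syzygyι q).hom y - θ ((F.coverπ q).hom ((F.syzygyι q).hom y)) = _
    rw [coverπ_syzygyι_apply, map_zero, sub_zero]

/-- `a • id_{K_{q+1}}` factors as `λ' ∘ j_q` with `λ' : F_q → K_{q+1}`, for `a ∈ Ann M`.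
[folklore] -/
theorem exists_smul_eq_comp_syzygyι {a : R} (ha : a ∈ Module.annihilator R M) (q : ℕ) :
    ∃ lam' : F.coverObj q →ₗ[R] F.syzygyObj (q + 1),
      ∀ y, lam' ((F.syzygyι q).hom y) = a • y := by
  obtain ⟨θ, hθ⟩ := F.exists_lift_smul_of_mem_annihilator ha q
  let lam : F.coverObj q →ₗ[R] F.coverObj q := a • LinearMap.id - θ ∘ₗ (F.coverπ q).hom
  have hlam : ∀ f, (F.coverπ q).hom (lam f) = 0 := by
    intro f
    simp only [lam, LinearMap.sub_apply, LinearMap.smul_apply, LinearMap.id_coe, id_eq,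
      LinearMap.coe_comp, Function.comp_apply, map_sub, map_smul, hθ, sub_self]
  refine ⟨F.syzygyLift q lam hlam, fun y => ?_⟩
  apply F.syzygyι_injective q
  rw [syzygyι_syzygyLift, map_smul]
  change a • (F.syzygyι q).hom y - θ ((F.coverπ q).hom ((F.syzygyι q).hom y)) = _
  rw [coverπ_syzygyι_apply, map_zero, sub_zero]

/-- **`Ann M` annihilates `E^q`** for every `q`: multiplication by `a ∈ Ann M` on the resolution is
null-homotopic, so `a · K_q^* ⊆ B^q`. (Abstractly: `E^q ≅ Ext^q(M, R)` is an `R/Ann M`-module.)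
[folklore] -/
theorem smul_EMod_eq_zero_of_mem_annihilator {a : R} (ha : a ∈ Module.annihilator R M)
    (q : ℕ) (e : F.EMod q) : a • e = 0 := by
  induction e using Submodule.Quotient.induction_on with
  | H ψ =>
    rw [← Submodule.Quotient.mk_smul, Submodule.Quotient.mk_eq_zero]
    rcases q with _ | q
    · -- `E⁰ = M^*` and `a ψ = ψ(a • -) = 0`
      have : a • ψ = 0 := by
        ext m
        change a • ψ m = 0
        rw [← map_smul]
        exact (congrArg ψ (Module.mem_annihilator.mp ha m)).trans (map_zero ψ)
      rw [this]
      exact Submodule.zero_mem _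
    · obtain ⟨lam', hlam'⟩ := F.exists_smul_eq_comp_syzygyι ha q
      rw [mem_BSub_succ_iff]
      refine ⟨ψ ∘ₗ lam', ?_⟩
      ext y
      rw [dualRestrict_apply, LinearMap.comp_apply, hlam', map_smul, LinearMap.smul_apply]

/-! ## Projectivity of high syzygies and boundaries -/

/-- If `pd M ≤ n` then the syzygies `K_q`, `q ≥ n`, are projective. [folklore] -/
theorem projective_syzygyObj_of_hasProjectiveDimensionLE {n : ℕ}
    (hM : HasProjectiveDimensionLE (ModuleCat.of R M) n) :
    ∀ q, n ≤ q → Projective (F.syzygyObj q) := by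
  -- `K_q` has projective dimension `< n - q + 1` for `q ≤ n`
  have key : ∀ q, q ≤ n → HasProjectiveDimensionLT (F.syzygyObj q) (n - q + 1) := by
    intro q
    induction q with
    | zero =>
      intro _
      rw [Nat.sub_zero]
      exact hM
    | succ q ih =>
      intro hq
      have h := ih (by omega)
      have e : n - q + 1 = (n - (q + 1)) + 2 := by omega
      rw [e] at h
      exact ((F.shortExact_syzygy q).hasProjectiveDimensionLT_X₃_iff (n - (q + 1))
        inferInstance).mp h
  intro q hq
  induction q with
  | zero =>
    have h := key 0 (Nat.zero_le n)
    have hn : n = 0 := by omega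
    subst hn
    exact projective_iff_hasProjectiveDimensionLT_one.mpr h
  | succ q ih =>
    rcases Nat.lt_or_ge q n with hlt | hge
    · have h := key (q + 1) hlt
      have : n - (q + 1) + 1 = 1 := by omega
      rw [this] at h
      exact projective_iff_hasProjectiveDimensionLT_one.mpr h
    · haveI := ih hge
      have h1 : HasProjectiveDimensionLT (F.syzygyObj (q + 1)) (0 + 1) :=
        ((F.shortExact_syzygy q).hasProjectiveDimensionLT_X₃_iff 0 inferInstance).mp
          inferInstance
      exact projective_iff_hasProjectiveDimensionLT_one.mpr h1

/-- If `K_q` is projective then `j_q : K_{q+1} → F_q` has a retraction. [folklore] -/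
theorem exists_retraction_syzygyι (q : ℕ) [Projective (F.syzygyObj q)] :
    ∃ r : F.coverObj q →ₗ[R] F.syzygyObj (q + 1), ∀ y, r ((F.syzygyι q).hom y) = y := by
  haveI : Module.Projective R (F.syzygyObj q) := (F.syzygyObj q).projective_of_module_projective
  obtain ⟨s, hs⟩ := Module.projective_lifting_property (F.coverπ q).hom LinearMap.id
    (F.coverπ_surjective q)
  -- `id - s π` lands in `ker π = K_{q+1}`
  let lam : F.coverObj q →ₗ[R] F.coverObj q := LinearMap.id - s ∘ₗ (F.coverπ q).hom
  have hmem : ∀ f, (F.coverπ q).hom (lam f) = 0 := by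
    intro f
    have h1 := LinearMap.congr_fun hs ((F.coverπ q).hom f)
    simp only [LinearMap.coe_comp, Function.comp_apply, LinearMap.id_coe, id_eq] at h1
    simp only [lam, LinearMap.sub_apply, LinearMap.id_coe, id_eq, LinearMap.coe_comp,
      Function.comp_apply, map_sub, h1, sub_self]
  refine ⟨F.syzygyLift q lam hmem, fun y => ?_⟩
  apply F.syzygyι_injective q
  rw [syzygyι_syzygyLift]
  change (F.syzygyι q).hom y - s ((F.coverπ q).hom ((F.syzygyι q).hom y)) = _
  rw [coverπ_syzygyι_apply, map_zero, sub_zero]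

/-- If `K_q` is projective then `F_q^* → K_{q+1}^*` is surjective, i.e. `B^{q+1} = K_{q+1}^*`.
[folklore] -/
theorem BSub_succ_eq_top (q : ℕ) [Projective (F.syzygyObj q)] : F.BSub (q + 1) = ⊤ := by
  obtain ⟨r, hr⟩ := F.exists_retraction_syzygyι q
  rw [BSub_succ, eq_top_iff]
  rintro ψ -
  refine ⟨ψ ∘ₗ r, ?_⟩
  ext y
  rw [dualRestrict_apply, LinearMap.comp_apply, hr]

/-- If `pd M ≤ n` then the boundary modules `B^q`, `q > n`, are projective. [folklore] -/
theorem projective_B_of_hasProjectiveDimensionLE {n : ℕ}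
    (hM : HasProjectiveDimensionLE (ModuleCat.of R M) n) (q : ℕ) (hq : n < q) :
    Projective (F.staircase.B q) := by
  obtain ⟨q, rfl⟩ : ∃ q', q = q' + 1 := ⟨q - 1, by omega⟩
  haveI : Projective (F.syzygyObj q) :=
    F.projective_syzygyObj_of_hasProjectiveDimensionLE hM q (by omega)
  haveI : Projective (F.syzygyObj (q + 1)) :=
    F.projective_syzygyObj_of_hasProjectiveDimensionLE hM (q + 1) (by omega)
  haveI : Module.Projective R (F.syzygyObj (q + 1)) :=
    (F.syzygyObj (q + 1)).projective_of_module_projective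
  -- `B^{q+1} = K_{q+1}^*` is the dual of a finite projective module
  have htop := F.BSub_succ_eq_top q
  let e : F.BSub (q + 1) ≃ₗ[R] Dual R (F.syzygyObj (q + 1)) :=
    (LinearEquiv.ofEq _ _ htop).trans Submodule.topEquiv
  haveI : Module.Projective R (F.BSub (q + 1)) := Module.Projective.of_equiv e.symm
  change Projective (ModuleCat.of R (F.BSub (q + 1)))
  infer_instance

/-! ## Finiteness -/

section Noetherian

variable [IsNoetherianRing R]

/-- `K_q^*` is a finite module over a Noetherian ring (a submodule of `F_q^* ≅ R^{rank q}`).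
[folklore] -/
instance finite_dual_syzygyObj (q : ℕ) : Module.Finite R (Dual R (F.syzygyObj q)) :=
  Module.Finite.of_injective (F.dualInflate q) (F.dualInflate_injective q)

/-- `E^q` is a finite module over a Noetherian ring. [folklore] -/
instance finite_EMod (q : ℕ) : Module.Finite R (F.EMod q) := inferInstance

end Noetherian

end FreeResolution

end Literature.AlgebraicGeometry.Resolution

end
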